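import Summits.BirchSwinnertonDyer.BirchSwinnertonDyer.Theorems.CongruentShaFreeCutBDPUpToSeriesRigidity
import Summits.BirchSwinnertonDyer.BirchSwinnertonDyer.Theorems.MordellShaFreeCutThreeAdicBDPTriple
import HarnessLib

set_option linter.dupNamespace false -- `Summit.BirchSwinnertonDyer.BirchSwinnertonDyer.Theorems.…` (summit = sub)
set_option autoImplicit false

/-!
# Route `MordellShaFreeCut` (rung S2b) — LEMMA R∞ for the EXACT frame and its reading for (LB-wan): the
# `∀`-tuple divisibility stub `ThreeAdicWanDivisibility` says no more than ONE tuple (SERVICE TWIN of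
# `CongruentShaFreeCutBDPUpToSeriesRigidity.lean` §3, `2 ↦ 3`, `E_n ↦` the `j = 0` curve `W`, `C = C' = 1`)

Cell `bsd-cn100`, prover seat `bsd-cn100-transfer` (g11), plan g15 RULING-4 (2026-08-27T01:22:06Z) «p-general
if the proof allows (S2b exact frame covered by C = C′ = 1)». Supports, does not close,
stmt-BirchSwinnertonDyer-19159 (line `heegner-field-bdp-triple` v6bq, stub `stub_threeAdicWanDivisibility`).
THEOREMS ONLY; imports no `Theses` module directly. PARTITION: none — RANK axis. HONEST FRAMING: nothing about
(LB-wan) itself is asserted.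

* §1 `seriesRigidity_of_isBDPLFunction` (any `p`) — two EXACT frames `IsBDPLFunction ι 𝔭 κ γ f Ω_K Ω_p 𝓛`,
  `IsBDPLFunction ι 𝔭 κ γ f Ω'_K Ω'_p 𝓛'` of the same `(ι, 𝔭, κ, γ, f)` satisfy `p^a·𝓛' = p^b·(w·𝓛)`,
  `w ∈ R₀⟦T⟧ˣ` (`seriesRigidity_of_isBDPLFunctionUpTo` with `C = C' = 1`).
* §2 **`threeAdicWanDivisibility_of_frameDivisibility`** — `ThreeAdicWanDivisibility` follows from the
  divisibility for ONE exact tuple `(Ω_K, Ω_p, 𝓛)` per datum.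

References: [Castella2018] Thm. 3.1; [Washington1997] §7.1–7.2; [CastellaGrossiLeeSkinner2022] Thm. 4.2.2
(shape; nothing asserted).
-/

noncomputable section

open scoped Classical

open PowerSeries WeierstrassCurve NumberField IsDedekindDomain Field
  Literature.NumberTheory.EllipticCurves Literature.NumberTheory.EllipticCurves.ModularForms
  Literature.NumberTheory.QuadraticFields Literature.NumberTheory.EllipticCurves.Castella2018
  Literature.NumberTheory.GaloisRepresentations Literature.NumberTheory.GaloisCohomology
  Summit.BirchSwinnertonDyer.BirchSwinnertonDyer.Theorems.CongruentShaFreeCutBDPUpToSeriesRigidity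
  Summit.BirchSwinnertonDyer.BirchSwinnertonDyer.Theorems.MordellShaFreeCutThreeAdicBDPTriple

namespace Summit.BirchSwinnertonDyer.BirchSwinnertonDyer.Theorems.MordellShaFreeCutBDPSeriesRigidityCensus

variable {p : ℕ} [hp : Fact p.Prime]

/-! ### §1 LEMMA R∞ for the exact frame (any `p`) -/

section Frame

variable {K : Type} [Field K] [NumberField K] {N : ℕ} {ι : PadicAlgCl p ≃+* ℂ}
  {𝔭 : HeightOneSpectrum (𝓞 K)} {κ : ZpExtension K p} {γ : Field.absoluteGaloisGroup K}
  {f : CuspForm (CongruenceSubgroup.Gamma0 N) 2} {ΩK ΩK' : ℂ} {Ωp Ωp' : ℂ_[p]} {L L' : UnrSeries p}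

/-- **LEMMA R∞ for the EXACT frame** (any `p`): two exact BDP elements `IsBDPLFunction ι 𝔭 κ γ f Ω_K Ω_p 𝓛`,
`IsBDPLFunction ι 𝔭 κ γ f Ω'_K Ω'_p 𝓛'` of the same `(ι, 𝔭, κ, γ, f)` (`K` imaginary quadratic, `κ`
anticyclotomic, `γ` a topological generator, periods non-zero) satisfy `p^a · 𝓛' = p^b · (w · 𝓛)` with `w`
a unit of `R₀⟦T⟧`. [cite: Castella2018, Thm. 3.1 (arXiv:1704.06608 p. 9)] [cite: Washington1997, §7.1–7.2] -/
theorem seriesRigidity_of_isBDPLFunction (hK : IsImaginaryQuadratic K) (hκ : κ.IsAnticyclotomic)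
    (hγ : κ.IsTopGenerator γ) (hΩK : ΩK ≠ 0) (hΩK' : ΩK' ≠ 0) (hΩp : Ωp ≠ 0) (hΩp' : Ωp' ≠ 0)
    (hL : IsBDPLFunction ι 𝔭 κ γ f ΩK Ωp L) (hL' : IsBDPLFunction ι 𝔭 κ γ f ΩK' Ωp' L') :
    ∃ (a b : ℕ) (w : UnrSeries p), IsUnit w ∧
      PowerSeries.C (((p : ℕ) : unrIntegers p) ^ a) * L' =
        PowerSeries.C (((p : ℕ) : unrIntegers p) ^ b) * (w * L) :=
  seriesRigidity_of_isBDPLFunctionUpTo hK hκ hγ hΩK hΩK' hΩp hΩp' one_ne_zero one_ne_zero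
    (isBDPLFunctionUpTo_one_iff.mpr hL) (isBDPLFunctionUpTo_one_iff.mpr hL')

end Frame

/-! ### §2 The reading census for (LB-wan) on S2b -/

/-- **READING CENSUS for (LB-wan) on S2b.** The `∀`-tuple stub `ThreeAdicWanDivisibility` — for EVERY exact
BDP element `(Ω_K, Ω_p, 𝓛)` the divisibility `3^k · j_*(char_Λ 𝔛) ⊆ (𝓛)` — follows from the SAME
divisibility for ONE exact tuple per datum `(W, ι', K, N, Dt, v, v̄, κ, γ)`: two exact elements differ by
`Frac(R₀)ˣ · R₀⟦T⟧ˣ` (`seriesRigidity_of_isBDPLFunction`) and the divisibility transfers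
(`exists_pow_mul_mem_span_of_rel`). Nothing about (LB-wan) itself is asserted.
[cite: CastellaGrossiLeeSkinner2022, Thm. 4.2.2 (shape; nothing asserted)] [cite: Castella2018, Thm. 3.1] -/
theorem threeAdicWanDivisibility_of_frameDivisibility
    (h1 : ∀ (W : WeierstrassCurve ℚ) [W.IsElliptic] [W.IsGloballyMinimal], W.j = 0 →
      ∀ (ι' : PadicAlgCl 3 ≃+* ℂ) (K : Type) [Field K] [NumberField K] (N : ℕ) [NeZero N]
        (Dt : ModularParametrizationData W N)
        (v vbar : HeightOneSpectrum (𝓞 K)) (κ : ZpExtension K 3) (γ : absoluteGaloisGroup K)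
        [Fact (κ.IsTopGenerator γ)],
      W.conductorNorm ℤ = N → IsImaginaryQuadratic K →
      SatisfiesHeegnerHypothesis N K → ((Ideal.span {(3 : ℤ)}).primesOver (𝓞 K)).ncard = 2 →
      (∀ (w : InfinitePlace K) (k : 𝓞 K), k ∈ v.asIdeal ↔ ‖ι'.symm (w.embedding (k : K))‖ < 1) →
      ((3 : ℕ) : 𝓞 K) ∈ vbar.asIdeal → vbar ≠ v → κ.IsAnticyclotomic →
      ∃ (ΩK : ℂ) (Ωp : (unrIntegers 3)ˣ) (L : UnrSeries 3),
        ΩK ≠ 0 ∧ IsBDPLFunction ι' v κ γ Dt.f ΩK ((Ωp : unrIntegers 3) : ℂ_[3]) L ∧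
        ∀ (j : ℤ_[3] →+* unrIntegers 3),
          (∀ x : ℤ_[3], ((j x : unrIntegers 3) : ℂ_[3]) = algebraMap ℚ_[3] ℂ_[3] (x : ℚ_[3])) →
          ∃ k : ℕ, ∀ F ∈ AcSelmer.XAc.charIdeal (W.baseChange K) 3 κ vbar ∅ γ,
            PowerSeries.C ((3 : unrIntegers 3) ^ k) * PowerSeries.map j F ∈ Ideal.span {L}) :
    ThreeAdicWanDivisibility := by
  intro W _ _ hj ι' K _ _ N _ Dt v vbar κ γ hγ hN hK hHN hsplit hv hvbar hne hκ ΩK₁ Ωp₁ L₁ hΩK₁ hL₁ j hjj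
  obtain ⟨ΩK₀, Ωp₀, L₀, hΩK₀, hL₀, hdiv⟩ := h1 W hj ι' K N Dt v vbar κ γ hN hK hHN hsplit hv hvbar hne hκ
  have hΩp₀ : ((Ωp₀ : unrIntegers 3) : ℂ_[3]) ≠ 0 := fun h ↦ (Units.ne_zero Ωp₀) (Subtype.ext h)
  have hΩp₁ : ((Ωp₁ : unrIntegers 3) : ℂ_[3]) ≠ 0 := fun h ↦ (Units.ne_zero Ωp₁) (Subtype.ext h)
  obtain ⟨a, b, w, hw, hrel⟩ := seriesRigidity_of_isBDPLFunction hK hκ hγ.out hΩK₀ hΩK₁ hΩp₀ hΩp₁ hL₀ hL₁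
  have h3 : ((3 : ℕ) : unrIntegers 3) = (3 : unrIntegers 3) := by norm_cast
  rw [h3] at hrel
  exact exists_pow_mul_mem_span_of_rel hw hrel (hdiv j hjj)

end Summit.BirchSwinnertonDyer.BirchSwinnertonDyer.Theorems.MordellShaFreeCutBDPSeriesRigidityCensus

end
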